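import Literature.NumberTheory.Automorphic.MeyerSummationSchwartz
import Literature.NumberTheory.Automorphic.MeyerSummationPoisson
import Literature.NumberTheory.Automorphic.MeyerDifferenceRepresentationProofs
import Literature.NumberTheory.Automorphic.StandardTestFunGaussian
import Mathlib.LinearAlgebra.Isomorphisms
import Mathlib.LinearAlgebra.Dimension.Constructions
import HarnessLib

/-!
# `π₊` is two-dimensional with spectrum `{1, |x|}` (Meyer (2005), §1 p. 5 and Lemma 5.5)

Topic `NumberTheory/Automorphic`; namespace `Literature.NumberTheory.Automorphic.Meyer`. Proof file
(theorems only) DISCHARGING the named fact `Meyer.piPlus_two_dimensional` of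
`MeyerDifferenceRepresentation` (R. Meyer, *On a representation of the idele class group related to
primes and zeros of L-functions*, Duke Math. J. 127 (2005), §1 p. 5: "This means that the
representation `π₊` is 2-dimensional and that `spec π₊ = {1, |x|}`"; Lemma 5.5: "The subspace
`i₊(H₊) + i₋(H₋)` of `𝒮(C_K)_{><}` is equal to `{(f₀, f₁) | f₀ - f₁ = c₀ - c₁|x|⁻¹}` … the quotient
by `H₋` is 2-dimensional … the remaining two basis vectors do arise because of `Sing`").

The proof follows Meyer's Lemma 5.5 with the difference map `D(f₀, f₁) = f₀ - f₁`:

* `D(H₊) ⊆ E = ℂ·1 + ℂ·|x|⁻¹` by the Poisson summation formula `JΣ𝔉 = Σ + Sing`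
  (`iPlus_fst_sub_snd` of `MeyerSummationPoisson`), `E` being translation invariant;
* `H₊ ⊆ 𝒮(C_K)_{(1,∞)} ⊕ 𝒮(C_K)_{(-∞,0)}` (**Lemmas 5.3–5.4**: `meyerSum_mem_ideleClassSchwartzWeighted_Ioi`
  of `MeyerSummationSchwartz`, Fourier stability `adeleFourier_mem_schwartzBruhatAdele`, and the
  `J`-lemma `invJ_mem_ideleClassSchwartzWeighted_Iio` of `MeyerArchOrbit`), whence the kernel of `D`
  on `H₊ + H₋` is exactly `i₋(H₋)` (interpolation `𝒮_{(1,∞)} ∩ 𝒮_{(-∞,0)} ⊆ 𝒮_ℝ = H₋`,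
  `mem_Hminus_of_mem_weighted_Ioi_of_mem_weighted_Iio`) and `H⁰₊ = (H₊ + H₋)/H₋ ≅ D(H₊)`
  equivariantly;
* `D(H₊) = E` has dimension `2`: a Gaussian test function `f` has `f(0) ≠ 0 ≠ 𝔉f(0)`, and a
  translate by an idele class of norm `≠ 1` produces the second vector;
* on `E` the regular representation has the joint eigenvectors `1` (character `1 = |x|^0`) and
  `|x|⁻¹` (character `|g| = |x|^1`) and no others; spectra are transported along the equivariant
  isomorphism (`jointSpectrum_eq_of_equiv` of `MeyerDifferenceRepresentationProofs`).

## References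

* R. Meyer, Duke Math. J. 127 (2005), 519–595 = arXiv:math/0311468, §1 p. 5, §5.3–5.5,
  Lemmas 5.3–5.5 [Meyer2005].
-/

noncomputable section

open MeasureTheory NumberField NumberField.InfinitePlace NumberField.mixedEmbedding IsDedekindDomain
  Filter Set
open scoped NNReal ENNReal Topology Classical

namespace Literature.NumberTheory.Automorphic.Meyer

variable (K : Type) [Field K] [NumberField K]

/-! ### The plane `E = ℂ·1 + ℂ·|x|⁻¹` and the regular representation on it -/

section Plane

/-- The function `|x|⁻¹` on `C_K` (as a complex-valued function). [cite: Meyer2005, Lemma 5.5] -/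
theorem normInv_apply_def (x : IdeleClassGroup K) :
    (fun y : IdeleClassGroup K => ((classNorm K y : ℝ) : ℂ)⁻¹) x = ((classNorm K x : ℝ) : ℂ)⁻¹ := rfl

variable {K}

/-- Translates of the constant function are constant. [folklore] -/
theorem classTranslate_const (g : IdeleClassGroup K) (c : ℂ) :
    classTranslate K g (fun _ : IdeleClassGroup K => c) = fun _ => c := rfl

/-- `λ_g |x|⁻¹ = |g| · |x|⁻¹`. [cite: Meyer2005, Lemma 5.5] -/
theorem classTranslate_normInv (g : IdeleClassGroup K) :
    classTranslate K g (fun y : IdeleClassGroup K => ((classNorm K y : ℝ) : ℂ)⁻¹) =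
      ((classNorm K g : ℝ) : ℂ) • fun y : IdeleClassGroup K => ((classNorm K y : ℝ) : ℂ)⁻¹ := by
  funext y
  rw [classTranslate_apply, Pi.smul_apply, smul_eq_mul, classNorm_mul]
  unfold classNorm
  rw [map_inv, NNReal.coe_inv]
  have hg : ((IdeleClassGroup.norm K g : ℝ) : ℂ) ≠ 0 := Complex.ofReal_ne_zero.2 (classNorm_ne_zero g)
  push_cast
  field_simp

/-- **There is an idele class of norm `≠ 1`** (the positive real idele `2` has norm `2^{[K:ℚ]}`).
[folklore] -/
theorem exists_classNorm_ne_one : ∃ g : IdeleClassGroup K, classNorm K g ≠ 1 := by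
  have h2 : (2 : ℝ≥0) ≠ 0 := two_ne_zero
  refine ⟨IdeleClassGroup.mk K (posRealIdele K (Units.mk0 2 h2)), ?_⟩
  change ((IdeleClassGroup.ideleNorm K (posRealIdele K (Units.mk0 2 h2)) : ℝ≥0) : ℝ) ≠ 1
  rw [ideleNorm_posRealIdele_holds K, Units.val_mk0, NNReal.coe_pow, NNReal.coe_ofNat]
  have hd : 0 < Module.finrank ℚ K := Module.finrank_pos
  have h : (1 : ℝ) < 2 ^ Module.finrank ℚ K := one_lt_pow₀ one_lt_two hd.ne'
  exact h.ne'

/-- **`1` and `|x|⁻¹` are linearly independent** functions on `C_K` (evaluate at `1` and at a class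
of norm `≠ 1`). [cite: Meyer2005, Lemma 5.5] -/
theorem linearIndependent_one_normInv :
    LinearIndependent ℂ ![(fun _ : IdeleClassGroup K => (1 : ℂ)),
      fun y : IdeleClassGroup K => ((classNorm K y : ℝ) : ℂ)⁻¹] := by
  rw [LinearIndependent.pair_iff]
  intro s t hst
  obtain ⟨g, hg⟩ := exists_classNorm_ne_one (K := K)
  have h1 := congrFun hst 1
  have h2 := congrFun hst g
  simp only [Pi.add_apply, Pi.smul_apply, smul_eq_mul, mul_one, Pi.zero_apply] at h1 h2
  rw [show classNorm K 1 = 1 by simp [classNorm], Complex.ofReal_one, inv_one, mul_one] at h1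
  have hg0 : ((classNorm K g : ℝ) : ℂ) ≠ 0 := Complex.ofReal_ne_zero.2 (classNorm_ne_zero g)
  have hg1 : ((classNorm K g : ℝ) : ℂ) ≠ 1 := fun h => hg (by exact_mod_cast h)
  have ht : t = 0 := by
    have h3 : t * (((classNorm K g : ℝ) : ℂ)⁻¹ - 1) = 0 := by linear_combination h2 - h1
    rcases mul_eq_zero.1 h3 with h | h
    · exact h
    · exfalso
      apply hg1
      have h4 : ((classNorm K g : ℝ) : ℂ)⁻¹ = 1 := sub_eq_zero.1 h
      rw [← inv_inv ((classNorm K g : ℝ) : ℂ), h4, inv_one]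
  refine ⟨?_, ht⟩
  rw [ht, add_zero] at h1
  exact h1

/-- **Joint eigenvectors of the regular representation in the plane `E = ℂ·1 + ℂ·|x|⁻¹`**: if
`v = s·1 + t·|x|⁻¹ ≠ 0` satisfies `λ_g v = χ(g) v` for all `g`, then `χ = 1 = |x|^0` or `χ = |x| = |x|^1`.
[cite: Meyer2005, §1 p. 5] -/
theorem eigenchar_eq_of_mem_plane {v : IdeleClassGroup K → ℂ} {s t : ℂ}
    (hv : s • (fun _ : IdeleClassGroup K => (1 : ℂ)) +
      t • (fun y : IdeleClassGroup K => ((classNorm K y : ℝ) : ℂ)⁻¹) = v) (hv0 : v ≠ 0)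
    {χ : IdeleClassGroup K → ℂ} (hχ : ∀ g, classTranslate K g v = χ g • v) :
    χ = normChar K 0 ∨ χ = normChar K 1 := by
  have hli := linearIndependent_one_normInv (K := K)
  rw [LinearIndependent.pair_iff] at hli
  -- coefficient comparison
  have hcoef : ∀ g, s - χ g * s = 0 ∧ t * ((classNorm K g : ℝ) : ℂ) - χ g * t = 0 := by
    intro g
    have h := hχ g
    rw [← hv, map_add, map_smul, map_smul, classTranslate_const, classTranslate_normInv, smul_add,
      smul_smul, smul_smul, smul_smul] at h
    have h' : (s - χ g * s) • (fun _ : IdeleClassGroup K => (1 : ℂ)) +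
        (t * ((classNorm K g : ℝ) : ℂ) - χ g * t) •
          (fun y : IdeleClassGroup K => ((classNorm K y : ℝ) : ℂ)⁻¹) = 0 := by
      rw [sub_smul, sub_smul]
      have := h
      calc s • (fun _ : IdeleClassGroup K => (1 : ℂ)) - (χ g * s) • (fun _ : IdeleClassGroup K => (1 : ℂ)) +
            ((t * ((classNorm K g : ℝ) : ℂ)) • (fun y : IdeleClassGroup K => ((classNorm K y : ℝ) : ℂ)⁻¹) -
              (χ g * t) • fun y : IdeleClassGroup K => ((classNorm K y : ℝ) : ℂ)⁻¹)
          = (s • (fun _ : IdeleClassGroup K => (1 : ℂ)) +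
              (t * ((classNorm K g : ℝ) : ℂ)) • fun y : IdeleClassGroup K => ((classNorm K y : ℝ) : ℂ)⁻¹) -
            ((χ g * s) • (fun _ : IdeleClassGroup K => (1 : ℂ)) +
              (χ g * t) • fun y : IdeleClassGroup K => ((classNorm K y : ℝ) : ℂ)⁻¹) := by abel
        _ = 0 := by rw [this, sub_self]
    exact hli _ _ h'
  by_cases hs : s = 0
  · -- `v = t |x|⁻¹`, `t ≠ 0`, `χ g = |g|`
    right
    have ht : t ≠ 0 := by
      rintro rfl
      apply hv0
      rw [← hv, hs, zero_smul, zero_smul, add_zero]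
    funext g
    have h := (hcoef g).2
    have h2 : χ g = ((classNorm K g : ℝ) : ℂ) := by
      have h3 : t * (((classNorm K g : ℝ) : ℂ) - χ g) = 0 := by linear_combination h
      rcases mul_eq_zero.1 h3 with h4 | h4
      · exact absurd h4 ht
      · exact (sub_eq_zero.1 h4).symm
    rw [h2, normChar, Complex.cpow_one]
  · -- `χ g = 1`
    left
    funext g
    have h := (hcoef g).1
    have h2 : χ g = 1 := by
      have h3 : s * (1 - χ g) = 0 := by linear_combination h
      rcases mul_eq_zero.1 h3 with h4 | h4
      · exact absurd h4 hs
      · exact (sub_eq_zero.1 h4).symm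
    rw [h2, normChar, Complex.cpow_zero]

/-- The difference of the two components commutes with translations:
`D(λ_g p) = λ_g (D p)`. [folklore] -/
theorem fst_sub_snd_classTranslate₂ (g : IdeleClassGroup K)
    (p : (IdeleClassGroup K → ℂ) × (IdeleClassGroup K → ℂ)) :
    (classTranslate₂ K g p).1 - (classTranslate₂ K g p).2 = classTranslate K g (p.1 - p.2) := by
  rw [classTranslate₂_apply, map_sub]

/-- **The plane `E` has dimension `2`.** [cite: Meyer2005, Lemma 5.5] -/
theorem finrank_span_one_normInv :
    Module.finrank ℂ ↥(Submodule.span ℂ ({(fun _ : IdeleClassGroup K => (1 : ℂ)),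
      fun y : IdeleClassGroup K => ((classNorm K y : ℝ) : ℂ)⁻¹} : Set (IdeleClassGroup K → ℂ))) = 2 := by
  have h := finrank_span_eq_card (linearIndependent_one_normInv (K := K))
  rw [Matrix.range_cons_cons_empty] at h
  simpa using h

end Plane

/-! ### The difference map on `H₊ + H₋` -/

section Difference

variable {K}
variable [MeasurableSpace (AdeleRing (𝓞 K) K)] [BorelSpace (AdeleRing (𝓞 K) K)]
  (μ : Measure (AdeleRing (𝓞 K) K)) [μ.IsAddHaarMeasure]

/-- **`D(i₊ f) = 𝔉f(0)·|x|⁻¹ - f(0)·1`** (Poisson summation, `iPlus_fst_sub_snd`).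
[cite: Meyer2005, §5.4] -/
theorem iPlus_fst_sub_snd_eq (hμ : μ (adeleFundamentalDomain K) = 1) {f : AdeleRing (𝓞 K) K → ℂ}
    (hf : f ∈ schwartzBruhatAdele K) :
    (iPlus K μ f).1 - (iPlus K μ f).2 =
      adeleFourier K μ f 0 • (fun y : IdeleClassGroup K => ((classNorm K y : ℝ) : ℂ)⁻¹) -
        f 0 • fun _ : IdeleClassGroup K => (1 : ℂ) := by
  funext c
  rw [Pi.sub_apply, iPlus_fst_sub_snd μ hμ hf c, Pi.sub_apply, Pi.smul_apply, Pi.smul_apply,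
    smul_eq_mul, smul_eq_mul, mul_one, mul_comm]

/-- **`D(H₊) ⊆ E`**: for `p ∈ H₊`, `p₀ - p₁ ∈ ℂ·1 + ℂ·|x|⁻¹`. [cite: Meyer2005, Lemma 5.5] -/
theorem fst_sub_snd_mem_span_of_mem_Hplus (hμ : μ (adeleFundamentalDomain K) = 1)
    {p : (IdeleClassGroup K → ℂ) × (IdeleClassGroup K → ℂ)} (hp : p ∈ Hplus K μ) :
    p.1 - p.2 ∈ Submodule.span ℂ ({(fun _ : IdeleClassGroup K => (1 : ℂ)),
      fun y : IdeleClassGroup K => ((classNorm K y : ℝ) : ℂ)⁻¹} : Set (IdeleClassGroup K → ℂ)) := by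
  induction hp using Submodule.span_induction with
  | mem p h =>
    obtain ⟨c, f, hf, rfl⟩ := h
    rw [fst_sub_snd_classTranslate₂, iPlus_fst_sub_snd_eq μ hμ hf, map_sub, map_smul, map_smul,
      classTranslate_const, classTranslate_normInv, smul_smul]
    exact sub_mem (Submodule.smul_mem _ _ (Submodule.subset_span (by simp)))
      (Submodule.smul_mem _ _ (Submodule.subset_span (by simp)))
  | zero => simp
  | add p q _ _ hp hq =>
    have h : (p + q).1 - (p + q).2 = (p.1 - p.2) + (q.1 - q.2) := by
      simp only [Prod.fst_add, Prod.snd_add]; abel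
    rw [h]
    exact add_mem hp hq
  | smul a p _ hp =>
    have h : (a • p).1 - (a • p).2 = a • (p.1 - p.2) := by
      simp only [Prod.smul_fst, Prod.smul_snd, smul_sub]
    rw [h]
    exact Submodule.smul_mem _ _ hp

/-- **`H₊ ⊆ 𝒮(C_K)_{(1,∞)} ⊕ 𝒮(C_K)_{(-∞,0)}`** (Meyer's Lemmas 5.3–5.4: `Σ f ∈ 𝒮(C_K)_{(1,∞)}`,
`𝔉f ∈ 𝒮(𝔸_K)`, `J : 𝒮_{(1,∞)} → 𝒮_{(-∞,0)}`, and translation invariance).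
[cite: Meyer2005, Lemmas 5.3–5.4] -/
theorem Hplus_le_schwartzPM : Hplus K μ ≤ schwartzPM K := by
  rw [Hplus, Submodule.span_le]
  rintro p ⟨c, f, hf, rfl⟩
  rw [SetLike.mem_coe, schwartzPM, Submodule.mem_prod, classTranslate₂_apply]
  constructor
  · exact classTranslate_mem_ideleClassSchwartzWeighted (meyerSum_mem_ideleClassSchwartzWeighted_Ioi hf) c
  · exact classTranslate_mem_ideleClassSchwartzWeighted (invJ_mem_ideleClassSchwartzWeighted_Iio
      (meyerSum_mem_ideleClassSchwartzWeighted_Ioi (adeleFourier_mem_schwartzBruhatAdele μ hf))) c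

/-- **The kernel of `D` on `H₊ + H₋` is `i₋(H₋)`**: an element of `H₊ + H₋` with equal components
lies on the diagonal of `H₋ = 𝒮(C_K)_ℝ` (interpolation `𝒮_{(1,∞)} ∩ 𝒮_{(-∞,0)} ⊆ 𝒮_ℝ`).
[cite: Meyer2005, Lemma 5.5] -/
theorem mem_HminusIm_of_fst_sub_snd_eq_zero {p : (IdeleClassGroup K → ℂ) × (IdeleClassGroup K → ℂ)}
    (hp : p ∈ Hsum K μ) (h0 : p.1 - p.2 = 0) : p ∈ HminusIm K := by
  obtain ⟨a, ha, b, hb, rfl⟩ := Submodule.mem_sup.1 hp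
  obtain ⟨h, hh, rfl⟩ := hb
  have hab : a.1 - a.2 = 0 := by
    have h1 : (a + iMinus K h).1 - (a + iMinus K h).2 = a.1 - a.2 := by
      simp only [Prod.fst_add, Prod.snd_add, iMinus_apply]; abel
    rw [← h1, h0]
  have ha12 : a.1 = a.2 := sub_eq_zero.1 hab
  obtain ⟨ha1, ha2⟩ := (Submodule.mem_prod.1 (Hplus_le_schwartzPM μ ha))
  rw [← ha12] at ha2
  have haH : a.1 ∈ Hminus K := mem_Hminus_of_mem_weighted_Ioi_of_mem_weighted_Iio ha1 ha2
  have haeq : a = iMinus K a.1 := by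
    rw [iMinus_apply]
    exact Prod.ext rfl ha12.symm
  refine add_mem ?_ ⟨h, hh, rfl⟩
  rw [haeq]
  exact ⟨a.1, haH, rfl⟩

/-- The difference map `D : H₊ + H₋ → (C_K → ℂ)`, `(p₀, p₁) ↦ p₀ - p₁`, restricted to `H₊ + H₋`, has
kernel exactly `H₋ ⊆ H₊ + H₋`. [cite: Meyer2005, Lemma 5.5] -/
theorem ker_fst_sub_snd_comp_subtype_eq_HminusIn :
    LinearMap.ker ((LinearMap.fst ℂ (IdeleClassGroup K → ℂ) (IdeleClassGroup K → ℂ) -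
      LinearMap.snd ℂ (IdeleClassGroup K → ℂ) (IdeleClassGroup K → ℂ)).comp (Hsum K μ).subtype) =
      HminusIn K μ := by
  ext q
  rw [LinearMap.mem_ker, HminusIn, Submodule.mem_comap]
  constructor
  · intro hq
    exact mem_HminusIm_of_fst_sub_snd_eq_zero μ q.2 hq
  · rintro ⟨h, hh, hq⟩
    change (q : (IdeleClassGroup K → ℂ) × (IdeleClassGroup K → ℂ)).1 -
      (q : (IdeleClassGroup K → ℂ) × (IdeleClassGroup K → ℂ)).2 = 0
    have hq' : (q : (IdeleClassGroup K → ℂ) × (IdeleClassGroup K → ℂ)) = iMinus K h := hq.symm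
    rw [hq', iMinus_apply, sub_self]

/-- **A test function with `f(0) ≠ 0` and `𝔉f(0) = ∫ f ≠ 0`** (the Gaussian standard test function
of `StandardTestFunGaussian`: positive, integrable, positive at `0`), for every additive Haar measure;
it yields `p = i₊ f ∈ H₊` with `D p = b·|x|⁻¹ - a·1`, `a, b ≠ 0`. [folklore] -/
theorem exists_mem_schwartzBruhatAdele_apply_zero_ne_zero :
    ∃ (f : AdeleRing (𝓞 K) K → ℂ), f ∈ schwartzBruhatAdele K ∧ f 0 ≠ 0 ∧ adeleFourier K μ f 0 ≠ 0 := by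
  haveI := isAddHaarMeasure_map_funUnique_symm μ
  set F : (Fin 1 → AdeleRing (𝓞 K) K) → ℂ := fun v =>
    ((standardTestFun 1 K (gaussArchTestFun 1 K) v : ℝ) : ℂ) with hF
  have hFmem : F ∈ piSchwartzBruhat K (Fin 1) := standardTestFun_gauss_mem_piSchwartzBruhat 1 K
  refine ⟨fun x => F fun _ => x, ?_, ?_, ?_⟩
  · rw [mem_schwartzBruhatAdele_iff]
    have heq : (fun v : Fin 1 → AdeleRing (𝓞 K) K => F fun _ : Fin 1 => v 0) = F := by
      funext v
      congr 1
      funext i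
      rw [Subsingleton.elim i 0]
    rw [heq]
    exact hFmem
  · rw [hF]
    change ((standardTestFun 1 K (gaussArchTestFun 1 K) (fun _ => (0 : AdeleRing (𝓞 K) K)) : ℝ) : ℂ) ≠ 0
    rw [Complex.ofReal_ne_zero]
    refine (standardTestFun_gauss_pos_of_mem 1 K fun i w => ?_).ne'
    rw [show ((0 : AdeleRing (𝓞 K) K)).2 w = 0 from rfl]
    exact zero_mem _
  · have h0 : adeleFourier K μ (fun x => F fun _ => x) 0 =
        ∫ v, F v ∂(μ.map (MeasurableEquiv.funUnique (Fin 1) (AdeleRing (𝓞 K) K)).symm) := by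
      rw [adeleFourier, integral_map_equiv]
      refine integral_congr_ae (ae_of_all _ fun x => ?_)
      simp only [mul_zero, AddChar.map_zero_eq_one, Circle.coe_one, mul_one]
      rfl
    rw [h0, hF]
    exact integral_ofReal_standardTestFun_gauss_ne_zero 1 K _

/-- **`D(H₊ + H₋) = E = ℂ·1 + ℂ·|x|⁻¹`**: the range of the difference map on `H₊ + H₋` is the plane
("the remaining two basis vectors do arise because of `Sing`"). [cite: Meyer2005, Lemma 5.5] -/
theorem range_fst_sub_snd_comp_subtype_eq_span (hμ : μ (adeleFundamentalDomain K) = 1) :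
    LinearMap.range ((LinearMap.fst ℂ (IdeleClassGroup K → ℂ) (IdeleClassGroup K → ℂ) -
      LinearMap.snd ℂ (IdeleClassGroup K → ℂ) (IdeleClassGroup K → ℂ)).comp (Hsum K μ).subtype) =
      Submodule.span ℂ ({(fun _ : IdeleClassGroup K => (1 : ℂ)),
        fun y : IdeleClassGroup K => ((classNorm K y : ℝ) : ℂ)⁻¹} : Set (IdeleClassGroup K → ℂ)) := by
  set one : IdeleClassGroup K → ℂ := fun _ => 1 with hone
  set nrmInv : IdeleClassGroup K → ℂ := fun y => ((classNorm K y : ℝ) : ℂ)⁻¹ with hnrm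
  set Dsub := (LinearMap.fst ℂ (IdeleClassGroup K → ℂ) (IdeleClassGroup K → ℂ) -
      LinearMap.snd ℂ (IdeleClassGroup K → ℂ) (IdeleClassGroup K → ℂ)).comp (Hsum K μ).subtype with hD
  have hDapply : ∀ q : Hsum K μ, Dsub q = (q : (IdeleClassGroup K → ℂ) × (IdeleClassGroup K → ℂ)).1 -
      (q : (IdeleClassGroup K → ℂ) × (IdeleClassGroup K → ℂ)).2 := fun q => rfl
  refine le_antisymm ?_ ?_
  · rintro _ ⟨q, rfl⟩
    rw [hDapply]
    obtain ⟨a, ha, b, hb, hq⟩ := Submodule.mem_sup.1 q.2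
    obtain ⟨h, hh, rfl⟩ := hb
    rw [← hq]
    have h1 : (a + iMinus K h).1 - (a + iMinus K h).2 = a.1 - a.2 := by
      simp only [Prod.fst_add, Prod.snd_add, iMinus_apply]; abel
    rw [h1]
    exact fst_sub_snd_mem_span_of_mem_Hplus μ hμ ha
  · -- the two basis vectors are in the range
    obtain ⟨f, hf, hf0, hFf0⟩ := exists_mem_schwartzBruhatAdele_apply_zero_ne_zero μ
    obtain ⟨g, hg⟩ := exists_classNorm_ne_one (K := K)
    have hmemD : ∀ p (hp : p ∈ Hplus K μ), p.1 - p.2 ∈ LinearMap.range Dsub := fun p hp =>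
      ⟨⟨p, Submodule.mem_sup_left hp⟩, rfl⟩
    have hp₁ : iPlus K μ f ∈ Hplus K μ := iPlus_mem_Hplus hf
    have hp₂ : classTranslate₂ K g (iPlus K μ f) ∈ Hplus K μ := Hplus_le_comap μ g hp₁
    have hv₁ : adeleFourier K μ f 0 • nrmInv - f 0 • one ∈ LinearMap.range Dsub := by
      have h := hmemD _ hp₁
      rwa [iPlus_fst_sub_snd_eq μ hμ hf] at h
    have hv₂ : (adeleFourier K μ f 0 * ((classNorm K g : ℝ) : ℂ)) • nrmInv - f 0 • one ∈ LinearMap.range Dsub := by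
      have h := hmemD _ hp₂
      rwa [fst_sub_snd_classTranslate₂, iPlus_fst_sub_snd_eq μ hμ hf, map_sub, map_smul, map_smul,
        classTranslate_const, classTranslate_normInv, smul_smul] at h
    -- `nrmInv ∈ range`
    have hcoef : adeleFourier K μ f 0 * ((classNorm K g : ℝ) : ℂ) - adeleFourier K μ f 0 ≠ 0 := by
      rw [← mul_sub_one]
      refine mul_ne_zero hFf0 (sub_ne_zero.2 fun h => hg ?_)
      exact_mod_cast h
    have hnrm_mem : nrmInv ∈ LinearMap.range Dsub := by
      have h := sub_mem hv₂ hv₁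
      have h2 : (adeleFourier K μ f 0 * ((classNorm K g : ℝ) : ℂ)) • nrmInv - f 0 • one -
          (adeleFourier K μ f 0 • nrmInv - f 0 • one) =
          (adeleFourier K μ f 0 * ((classNorm K g : ℝ) : ℂ) - adeleFourier K μ f 0) • nrmInv := by
        rw [sub_smul]; abel
      rw [h2] at h
      have h3 := Submodule.smul_mem _ (adeleFourier K μ f 0 * ((classNorm K g : ℝ) : ℂ) -
        adeleFourier K μ f 0)⁻¹ h
      rwa [smul_smul, inv_mul_cancel₀ hcoef, one_smul] at h3
    have hone_mem : one ∈ LinearMap.range Dsub := by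
      have h := sub_mem (Submodule.smul_mem _ (adeleFourier K μ f 0) hnrm_mem) hv₁
      have h2 : adeleFourier K μ f 0 • nrmInv - (adeleFourier K μ f 0 • nrmInv - f 0 • one) = f 0 • one := by
        abel
      rw [h2] at h
      have h3 := Submodule.smul_mem _ (f 0)⁻¹ h
      rwa [smul_smul, inv_mul_cancel₀ hf0, one_smul] at h3
    rw [Submodule.span_le]
    intro v hv
    rcases hv with rfl | rfl
    · exact hone_mem
    · exact hnrm_mem

end Difference

/-! ### The discharge -/

section Holds

variable {K}
variable [MeasurableSpace (AdeleRing (𝓞 K) K)] [BorelSpace (AdeleRing (𝓞 K) K)]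
  (μ : Measure (AdeleRing (𝓞 K) K)) [μ.IsAddHaarMeasure]

/-- **Meyer (2005), §1 p. 5 and Lemma 5.5: `π₊` is two-dimensional with spectrum `{1, |x|}`**, for
every number field `K` and the Haar measure on `𝔸_K` with `μ(𝔸_K ⧸ K) = 1`: the named fact
`Meyer.piPlus_two_dimensional` holds. The representation `π₊` of `C_K` on
`H⁰₊ = (H₊ + H₋)/H₋` is identified, through the difference map `(f₀, f₁) ↦ f₀ - f₁`, with the regular
representation on the plane `ℂ·1 + ℂ·|x|⁻¹`, whose joint eigenvectors are `1` (character `|x|^0`)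
and `|x|⁻¹` (character `|x|^1`). [cite: Meyer2005, §1 p. 5 and Lemma 5.5] -/
theorem piPlus_two_dimensional_holds : piPlus_two_dimensional := by
  intro K _ _ _ _ μ _ hμ
  -- the difference map and its kernel / range
  set Dsub := (LinearMap.fst ℂ (IdeleClassGroup K → ℂ) (IdeleClassGroup K → ℂ) -
      LinearMap.snd ℂ (IdeleClassGroup K → ℂ) (IdeleClassGroup K → ℂ)).comp (Hsum K μ).subtype with hD
  have hDapply : ∀ q : Hsum K μ, Dsub q = (q : (IdeleClassGroup K → ℂ) × (IdeleClassGroup K → ℂ)).1 -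
      (q : (IdeleClassGroup K → ℂ) × (IdeleClassGroup K → ℂ)).2 := fun q => rfl
  have hker : LinearMap.ker Dsub = HminusIn K μ := ker_fst_sub_snd_comp_subtype_eq_HminusIn μ
  have hrange := range_fst_sub_snd_comp_subtype_eq_span μ hμ
  -- equivariance of `Dsub`
  have hDequiv : ∀ (g : IdeleClassGroup K) (q : Hsum K μ),
      Dsub (sumRep K μ g q) = classTranslate K g (Dsub q) := by
    intro g q
    rw [hDapply, hDapply]
    exact fst_sub_snd_classTranslate₂ g _
  -- the range is translation invariant; the regular representation on it
  have hRinv : ∀ g : IdeleClassGroup K, LinearMap.range Dsub ≤ (LinearMap.range Dsub).comap (classTranslate K g) := by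
    rintro g _ ⟨q, rfl⟩
    rw [Submodule.mem_comap, ← hDequiv]
    exact ⟨_, rfl⟩
  set τ : Representation ℂ (IdeleClassGroup K) ↥(LinearMap.range Dsub) :=
    (classTranslate K).subrepresentation (LinearMap.range Dsub) hRinv with hτ
  -- the equivariant isomorphism `H⁰₊ ≅ range Dsub`
  set Φ : HzeroPlus K μ ≃ₗ[ℂ] ↥(LinearMap.range Dsub) :=
    (Submodule.quotEquivOfEq _ _ hker.symm).trans Dsub.quotKerEquivRange with hΦ
  have hΦmk : ∀ q : Hsum K μ, (Φ (Submodule.Quotient.mk q) : IdeleClassGroup K → ℂ) = Dsub q := by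
    intro q
    rw [hΦ, LinearEquiv.trans_apply, Submodule.quotEquivOfEq_mk, LinearMap.quotKerEquivRange_apply_mk]
  have hequiv : ∀ (g : IdeleClassGroup K) (v : HzeroPlus K μ), Φ (piPlus K μ g v) = τ g (Φ v) := by
    intro g v
    induction v using Submodule.Quotient.induction_on with
    | H q =>
      apply Subtype.ext
      have h1 : piPlus K μ g (Submodule.Quotient.mk q) = Submodule.Quotient.mk (sumRep K μ g q) := rfl
      rw [h1, hΦmk]
      change Dsub (sumRep K μ g q) = classTranslate K g (Φ (Submodule.Quotient.mk q) : IdeleClassGroup K → ℂ)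
      rw [hΦmk, hDequiv]
  refine ⟨?_, ?_⟩
  · -- dimension
    rw [LinearEquiv.finrank_eq Φ, LinearEquiv.finrank_eq (LinearEquiv.ofEq _ _ hrange)]
    exact finrank_span_one_normInv
  · -- spectrum
    rw [jointSpectrum_eq_of_equiv Φ hequiv]
    apply Set.Subset.antisymm
    · -- `⊆`
      rintro χ ⟨v, hv0, hv⟩
      have hvE : (v : IdeleClassGroup K → ℂ) ∈ Submodule.span ℂ ({(fun _ : IdeleClassGroup K => (1 : ℂ)),
          fun y : IdeleClassGroup K => ((classNorm K y : ℝ) : ℂ)⁻¹} : Set (IdeleClassGroup K → ℂ)) := by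
        rw [← hrange]; exact v.2
      obtain ⟨s, t, hst⟩ := Submodule.mem_span_pair.1 hvE
      have hv0' : (v : IdeleClassGroup K → ℂ) ≠ 0 := fun h => hv0 (Subtype.ext h)
      have hχ : ∀ g, classTranslate K g (v : IdeleClassGroup K → ℂ) = χ g • (v : IdeleClassGroup K → ℂ) :=
        fun g => by
          have h := congrArg Subtype.val (hv g)
          exact h
      rcases eigenchar_eq_of_mem_plane hst hv0' hχ with rfl | rfl
      · exact Or.inl rfl
      · exact Or.inr rfl
    · -- `⊇`
      have hone : (fun _ : IdeleClassGroup K => (1 : ℂ)) ∈ LinearMap.range Dsub := by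
        rw [hrange]; exact Submodule.subset_span (by simp)
      have hnrm : (fun y : IdeleClassGroup K => ((classNorm K y : ℝ) : ℂ)⁻¹) ∈ LinearMap.range Dsub := by
        rw [hrange]; exact Submodule.subset_span (by simp)
      rintro χ (rfl | rfl)
      · refine ⟨⟨_, hone⟩, fun h => one_ne_zero (congrFun (congrArg Subtype.val h) 1), fun g => ?_⟩
        apply Subtype.ext
        change classTranslate K g (fun _ : IdeleClassGroup K => (1 : ℂ)) = normChar K 0 g • fun _ => (1 : ℂ)
        rw [classTranslate_const, normChar, Complex.cpow_zero, one_smul]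
      · refine ⟨⟨_, hnrm⟩, fun h => ?_, fun g => ?_⟩
        · have h1 := congrFun (congrArg Subtype.val h) 1
          simp [classNorm] at h1
        · apply Subtype.ext
          change classTranslate K g (fun y : IdeleClassGroup K => ((classNorm K y : ℝ) : ℂ)⁻¹) =
            normChar K 1 g • fun y : IdeleClassGroup K => ((classNorm K y : ℝ) : ℂ)⁻¹
          rw [classTranslate_normInv, normChar, Complex.cpow_one]

end Holds

end Literature.NumberTheory.Automorphic.Meyer
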